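import Summits.QuantumFields.BalabanUV.Beta.D1BFx.ReducedKernelSandwichLeg

/-!
# `BalabanUV.Beta.D1BFx.ReducedKernelSandwichBlock` — road «BF-x» for binder row D1, sub-leaf A4-leg (part 3): THE SANDWICH / K-R5 CHAIN
# OVER ANY LEG UNDER **BLOCK** COVARIANCE ONLY, and THE DIAGONAL EXTENSION `diagExt` OF A ONE-BOND TABLE (the shape of the ghost contact
# table of T6/T7-gh) WITH ITS SOCKETS — the two generic pieces the ghost fine kernel `GhostKernel.Pgh` needs

HONEST DEPENDENCY (page 1, mandatory): continuum YM on T⁴ ⇐ BetaPertH ∧ nine spine estimates (0/9 proved); BetaPertH ⇐ (D1) ∧ (D4) ∧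
CAP+tail; G-an2-4 gates asym, D1 and NE2/3/4.  HONEST FRAMING (cell contract, verbatim): «discharging `BetaPertH` makes Bałaban's UV
stability UNCONDITIONAL — a real constructive-QFT result; it is NOT the continuum limit and NOT the Clay problem.»  One definition with a
body ([our object] `diagExt`) and [folklore] bookkeeping over parts 1–2 (`DressedTablesLeg`, `ReducedKernelSandwichLeg`) and K-R5; no
`def … : Prop`, no citation, no printed statement as hypothesis; 0 binders of the hR root touched; nothing of D1 / BetaPertH discharged.
ABSOLUTE RULE (cell charter, verbatim): «No internally-minted statement may enter as a cited fact. Every hypothesis is either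
kernel-proved in this package or a verbatim quotation of a PUBLISHED theorem with page reference. The manuscript(s) under audit are NOT
citable for their own disputed steps — they are the thing under adjudication; programme-internal (2001/route/tribunal) claims are never
citable.»

WHY.  Parts 1–2 copied leaf A4's hypothesis shape, FINE translation covariance of the stencils/tables (`S κ′ (u + v) = shiftK (−v) (S κ′ u)`
for EVERY fine `v`), but their proofs only ever use it at BLOCK vectors `v = n•t` — and the typer's ghost stencil `GhostStencil.Sgh` is
block-covariant ONLY (`Sgh_translate`: its `qAnti` part sees the block partition).  §1 re-runs the four END statements with the periodicity
of the two fine tables as the hypothesis (`…_of_periodic`) and with block covariance (`…_of_block`); the fine-covariant versions of part 2 are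
special cases.  §2: T6's second-order ghost table lives on ONE fine bond (`Wgh = [same bond]·cW·ghCnt`), and leaf-04's T7-gh dresses such a
table by the collapsed single superposition `tableRedDiag`; `diagExt T κ′ u λ′ u′ := [κ′ = λ′ ∧ u = u′]·T κ′ u` puts it in the two-bond slot
of the typer's `tableRedF`, where the inner superposition collapses to one term UNCONDITIONALLY (`tsum_eq_single`), and carries the sockets
(bi-localisation, block covariance, symmetry) the chain asks of a two-bond table.

CONTENT.
* §1 [folklore] `isBlockPeriodic_bubbleTableA_of_block`, `isBlockPeriodic_tadpoleTableA_of_block`, `isBlockPeriodic_fineHessA_of_block`;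
  `bubblePartA_eq_dressedEntryP_of_periodic`, `tadpolePartA_eq_dressedEntryP_of_periodic`, **`TOfLeg_tableRedF_eq_dressedEntryP_of_block`**,
  **`bondSecondMoment_TOfLeg_eq_avgM2_of_block`**, `secondMoment_TOfLeg_eq_of_block`, `bondSecondMoment_TOfLeg_eq_avgM2_of_inversion_of_block`.
* §2 [our object] `diagExt`; [folklore] `diagExt_apply`, `biLoc_diagExt`, `diagExt_symm`, `diagExt_translate`, `wsum_diagExt_apply`,
  **`tableRedF_diagExt_apply`** (`tableRedF n (diagExt T) μ y ν y′ x z a b = Σ_{κ′} Σ′_u ℋ_{(κ′,u),(μ,y)} ℋ_{(κ′,u),(ν,y′)} · T κ′ u x z a b` —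
  the body of `GhostKernel.tableRedDiag`, no hypothesis).
Unit `b2b-balaban-beta-d1-formalise-leaf-01` (gen 2).
-/

noncomputable section

namespace Summit.QuantumFields.BalabanUV.Beta.D1BFx.ReducedKernelSandwichBlock

open Finset
open scoped BigOperators
open Literature.MathematicalPhysics.QuantumFieldTheory.Balaban1983to89
open Literature.MathematicalPhysics.QuantumFieldTheory.Balaban1983to89.Beta
open B12Sec2to5 (l1 l1_nonneg)
open ExpKernelCalculus (Site MKer Decays BiLoc comp tr bubble tadpole hessKer shiftK)
open DecimatedMoment (cosetInd)
open DecimatedMomentSummable (AbsMoment₂)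
open DressedMomentNormalisation (EKer resSite)
open KernelSpecInstance (wH)
open MinimiserIdentityForm (wK absMoment₂_wK)
open OneStepResolventKernel (wsum)
open Summit.QuantumFields.BalabanUV.Beta.TameKernelCalculus
open Summit.QuantumFields.BalabanUV.Beta.D1BFx.ReducedKernelF (vertexRedF TOfLeg TOfLeg_eq)
open Summit.QuantumFields.BalabanUV.Beta.D1BFx.ReducedTableF (tableRedF tableRedF_apply)
open Summit.QuantumFields.BalabanUV.Beta.D1BFx.ReducedKernelSandwich (dressedEntryP_add)
open Summit.QuantumFields.BalabanUV.Beta.D1BFx.MomentTransferPeriodic (Ker₂ IsBlockPeriodic baseKer)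
open Summit.QuantumFields.BalabanUV.Beta.D1BFx.MomentTransferPeriodicSum (dressedSumP periodicMajorant absMoment₂_periodicMajorant
  abs_baseKer_le_periodicMajorant)
open Summit.QuantumFields.BalabanUV.Beta.D1BFx.MomentTransferPeriodicEntry (EKer₂ dressedEntryP avgM2
  bondSecondMomentP_solutionOp_four)
open Summit.QuantumFields.BalabanUV.Beta.D1BFx.MomentTransferParity (sum_firstMoment_baseKer_eq_zero_of_inversion)
open Summit.QuantumFields.BalabanUV.Beta.D1BFx.DressedTablesLeg
open Summit.QuantumFields.BalabanUV.Beta.D1BFx.ReducedKernelSandwichLeg (fineHessA fineHessA_apply absMoment₂_baseKer_fineHessA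
  fineHessA_transpose)

variable {F : Type*} [Fintype F]
variable (n : ℕ) [NeZero n] (A : MKer 4 F) {S : Fin 4 → Site 4 → MKer 4 F} {Wf : Fin 4 → Site 4 → Fin 4 → Site 4 → MKer 4 F}
  {Cs C2 δ : ℝ}

/-! ## §1 The chain under block covariance / table periodicity -/

omit [NeZero n] in
/-- [folklore] Block periodicity of the bubble table from BLOCK covariance of leg and stencils. -/
theorem isBlockPeriodic_bubbleTableA_of_block (hAcov : ∀ t : Site 4, shiftK (-((n : ℤ) • t)) A = A)
    (hScov : ∀ (κ' : Fin 4) (u t : Site 4), S κ' (u + (n : ℤ) • t) = shiftK (-((n : ℤ) • t)) (S κ' u)) (κ' l' : Fin 4) :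
    IsBlockPeriodic n (bubbleTableA A S κ' l') := by
  intro t s s'
  simp only [bubbleTableA_apply]
  rw [hScov κ' s t, hScov l' s' t]
  conv_lhs => rw [← hAcov t]
  rw [ExpKernelCalculus.bubble_shiftK]

omit [NeZero n] in
/-- [folklore] Block periodicity of the tadpole table from BLOCK covariance of leg and tables. -/
theorem isBlockPeriodic_tadpoleTableA_of_block (hAcov : ∀ t : Site 4, shiftK (-((n : ℤ) • t)) A = A)
    (hWcov : ∀ (κ' : Fin 4) (u : Site 4) (l' : Fin 4) (u' t : Site 4),
      Wf κ' (u + (n : ℤ) • t) l' (u' + (n : ℤ) • t) = shiftK (-((n : ℤ) • t)) (Wf κ' u l' u')) (κ' l' : Fin 4) :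
    IsBlockPeriodic n (tadpoleTableA A Wf κ' l') := by
  intro t s s'
  simp only [tadpoleTableA_apply]
  rw [hWcov κ' s l' s' t]
  conv_lhs => rw [← hAcov t]
  rw [ExpKernelCalculus.tadpole_shiftK]

omit [NeZero n] in
/-- [folklore] Block periodicity of the fine Hessian kernel from BLOCK covariance. -/
theorem isBlockPeriodic_fineHessA_of_block (hAcov : ∀ t : Site 4, shiftK (-((n : ℤ) • t)) A = A)
    (hScov : ∀ (κ' : Fin 4) (u t : Site 4), S κ' (u + (n : ℤ) • t) = shiftK (-((n : ℤ) • t)) (S κ' u))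
    (hWcov : ∀ (κ' : Fin 4) (u : Site 4) (l' : Fin 4) (u' t : Site 4),
      Wf κ' (u + (n : ℤ) • t) l' (u' + (n : ℤ) • t) = shiftK (-((n : ℤ) • t)) (Wf κ' u l' u')) (κ' l' : Fin 4) :
    IsBlockPeriodic n (fineHessA A S Wf κ' l') := fun t s s' => by
  simp only [fineHessA_apply, isBlockPeriodic_tadpoleTableA_of_block n A hAcov hWcov κ' l' t s s',
    isBlockPeriodic_bubbleTableA_of_block n A hAcov hScov κ' l' t s s']

variable [Nonempty F]

/-- [folklore] **THE BUBBLE PART IS THE SANDWICH OF THE BUBBLE TABLE**, with the table's BLOCK PERIODICITY as the hypothesis. -/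
theorem bubblePartA_eq_dressedEntryP_of_periodic (hA : Spr A) (hS : ∀ κ' u, BiLoc (S κ' u) u u Cs δ) (hδ : 0 < δ)
    (hper : ∀ κ' l' : Fin 4, IsBlockPeriodic n (bubbleTableA A S κ' l')) (μ ν : Fin 4) (z : Site 4) :
    -(1 / 2 : ℝ) * bubble A (vertexRedF n S μ 0) (vertexRedF n S ν z)
      = dressedEntryP (wK n) (bubbleTableA A S) ((n : ℤ) • (-z)) μ ν := by
  rw [bubble_vertexRedF n A hA hS hδ μ ν 0 z, Finset.mul_sum]
  simp only [dressedEntryP, dressedSumP]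
  refine Finset.sum_congr rfl fun κ' _ => ?_
  rw [Finset.mul_sum]
  refine Finset.sum_congr rfl fun l' _ => ?_
  rw [← tsum_mul_left]
  rw [← (Equiv.prodCongr (Equiv.refl (Site 4)) (Equiv.addRight ((n : ℤ) • z))).tsum_eq]
  refine tsum_congr fun q => ?_
  obtain ⟨u, x⟩ := q
  simp only [Equiv.prodCongr_apply, Prod.map_apply, Equiv.refl_apply, Equiv.coe_addRight, smul_zero, sub_zero,
    add_sub_cancel_right, bubbleTableA_apply]
  have hp := hper κ' l' (-z) u (x + (n : ℤ) • z)
  rw [bubbleTableA_apply, bubbleTableA_apply, smul_neg, show x + (n : ℤ) • z + -((n : ℤ) • z) = x by abel] at hp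
  rw [show (n : ℤ) • -z + u = u + -((n : ℤ) • z) by rw [smul_neg]; abel, hp]
  simp only [wK]
  ring

/-- [folklore] **THE TADPOLE PART IS THE SANDWICH OF THE TADPOLE TABLE**, with the table's BLOCK PERIODICITY as the hypothesis. -/
theorem tadpolePartA_eq_dressedEntryP_of_periodic (hA : Spr A) (hW : ∀ κ' u l' u', BiLoc (Wf κ' u l' u') u u' C2 δ) (hδ : 0 < δ)
    (hper : ∀ κ' l' : Fin 4, IsBlockPeriodic n (tadpoleTableA A Wf κ' l')) (μ ν : Fin 4) (z : Site 4) :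
    (1 / 2 : ℝ) * tadpole A (tableRedF n Wf μ 0 ν z) = dressedEntryP (wK n) (tadpoleTableA A Wf) ((n : ℤ) • (-z)) μ ν := by
  rw [tadpole_tableRedF n A hA hW hδ μ 0 ν z, Finset.mul_sum]
  simp only [dressedEntryP, dressedSumP]
  refine Finset.sum_congr rfl fun κ' _ => ?_
  rw [Finset.mul_sum]
  refine Finset.sum_congr rfl fun l' _ => ?_
  rw [← tsum_mul_left]
  rw [← (Equiv.prodCongr (Equiv.refl (Site 4)) (Equiv.addRight ((n : ℤ) • z))).tsum_eq]
  refine tsum_congr fun q => ?_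
  obtain ⟨u, x⟩ := q
  simp only [Equiv.prodCongr_apply, Prod.map_apply, Equiv.refl_apply, Equiv.coe_addRight, smul_zero, sub_zero,
    add_sub_cancel_right, tadpoleTableA_apply]
  have hp := hper κ' l' (-z) u (x + (n : ℤ) • z)
  rw [tadpoleTableA_apply, tadpoleTableA_apply, smul_neg, show x + (n : ℤ) • z + -((n : ℤ) • z) = x by abel] at hp
  rw [show (n : ℤ) • -z + u = u + -((n : ℤ) • z) by rw [smul_neg]; abel, hp]
  simp only [wK]
  ring

/-- [folklore] **THE REDUCED KERNEL OVER ANY LEG IS A SANDWICH — BLOCK-COVARIANT DATA SUFFICE**: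
`TOfLeg n A S (tableRedF n Wf) μ ν z = dressedEntryP (wK n) (fineHessA A S Wf) (n•(−z)) μ ν`. -/
theorem TOfLeg_tableRedF_eq_dressedEntryP_of_block (hA : Spr A) (hAcov : ∀ t : Site 4, shiftK (-((n : ℤ) • t)) A = A)
    (hS : ∀ κ' u, BiLoc (S κ' u) u u Cs δ) (hW : ∀ κ' u l' u', BiLoc (Wf κ' u l' u') u u' C2 δ) (hδ : 0 < δ)
    (hScov : ∀ (κ' : Fin 4) (u t : Site 4), S κ' (u + (n : ℤ) • t) = shiftK (-((n : ℤ) • t)) (S κ' u))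
    (hWcov : ∀ (κ' : Fin 4) (u : Site 4) (l' : Fin 4) (u' t : Site 4),
      Wf κ' (u + (n : ℤ) • t) l' (u' + (n : ℤ) • t) = shiftK (-((n : ℤ) • t)) (Wf κ' u l' u'))
    (μ ν : Fin 4) (z : Site 4) :
    TOfLeg n A S (tableRedF n Wf) μ ν z = dressedEntryP (wK n) (fineHessA A S Wf) ((n : ℤ) • (-z)) μ ν := by
  have hadd := dressedEntryP_add (Nat.pos_of_ne_zero (NeZero.ne n)) (wK n) (tadpoleTableA A Wf) (bubbleTableA A S) absMoment₂_wK
    (fun c e => isBlockPeriodic_tadpoleTableA_of_block n A hAcov hWcov c e)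
    (fun c e => isBlockPeriodic_bubbleTableA_of_block n A hAcov hScov c e)
    (fun c e b => absMoment₂_baseKer_tadpoleTableA A hA hW hδ c e b) (fun c e b => absMoment₂_baseKer_bubbleTableA A hA hS hδ c e b)
    ((n : ℤ) • (-z)) μ ν
  rw [TOfLeg_eq]
  show (1 / 2 : ℝ) * tadpole A (tableRedF n Wf μ 0 ν z) - (1 / 2 : ℝ) * bubble A (vertexRedF n S μ 0) (vertexRedF n S ν z) = _
  rw [sub_eq_add_neg, ← neg_mul,
    tadpolePartA_eq_dressedEntryP_of_periodic n A hA hW hδ (fun c e => isBlockPeriodic_tadpoleTableA_of_block n A hAcov hWcov c e),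
    bubblePartA_eq_dressedEntryP_of_periodic n A hA hS hδ (fun c e => isBlockPeriodic_bubbleTableA_of_block n A hAcov hScov c e),
    ← hadd]
  rfl

/-- [folklore] **A4 OVER ANY LEG, BLOCK-COVARIANT DATA — THE DRESSING CROSS TERMS VANISH.**  As
`ReducedKernelSandwichLeg.bondSecondMoment_TOfLeg_eq_avgM2` with block covariance of `S` and `Wf` in place of fine covariance; Ward rows
`hrow` and first moments `hT1` of `fineHessA A S Wf` STAY hypotheses. -/
theorem bondSecondMoment_TOfLeg_eq_avgM2_of_block (hA : Spr A) (hAcov : ∀ t : Site 4, shiftK (-((n : ℤ) • t)) A = A)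
    (hS : ∀ κ' u, BiLoc (S κ' u) u u Cs δ) (hW : ∀ κ' u l' u', BiLoc (Wf κ' u l' u') u u' C2 δ) (hδ : 0 < δ)
    (hScov : ∀ (κ' : Fin 4) (u t : Site 4), S κ' (u + (n : ℤ) • t) = shiftK (-((n : ℤ) • t)) (S κ' u))
    (hWcov : ∀ (κ' : Fin 4) (u : Site 4) (l' : Fin 4) (u' t : Site 4),
      Wf κ' (u + (n : ℤ) • t) l' (u' + (n : ℤ) • t) = shiftK (-((n : ℤ) • t)) (Wf κ' u l' u'))
    (hWsymm : ∀ (κ' : Fin 4) (u : Site 4) (l' : Fin 4) (u' : Site 4), Wf κ' u l' u' = Wf l' u' κ' u)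
    (hrow : ∀ (κ' l' : Fin 4) (b : Site 4), HasSum (fineHessA A S Wf κ' l' b) 0)
    (hT1 : ∀ (κ' l' μ' : Fin 4), ∑ r : Fin 4 → Fin n, ∑' t, (t μ' : ℝ) * baseKer (fineHessA A S Wf κ' l') (resSite r) t = 0)
    (κ lam μ ν : Fin 4) :
    ∑' z : Site 4, ((z κ * z lam : ℤ) : ℝ) * ((n : ℝ) ^ 8 * TOfLeg n A S (tableRedF n Wf) μ ν z)
      = avgM2 n (fineHessA A S Wf μ ν) κ lam := by
  have hcol : ∀ (κ' l' : Fin 4) (b : Site 4), HasSum (fun s => fineHessA A S Wf κ' l' s b) 0 := fun κ' l' b =>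
    (hrow l' κ' b).congr_fun fun s => fineHessA_transpose A hA hS hδ hWsymm κ' l' s b
  have h := bondSecondMomentP_solutionOp_four (N := n) (fineHessA A S Wf) (isBlockPeriodic_fineHessA_of_block n A hAcov hScov hWcov)
    (absMoment₂_baseKer_fineHessA A hA hS hW hδ) hcol hrow hT1 κ lam μ ν
  rw [← h, ← (Equiv.neg (Site 4)).tsum_eq]
  refine tsum_congr fun z => ?_
  rw [TOfLeg_tableRedF_eq_dressedEntryP_of_block n A hA hAcov hS hW hδ hScov hWcov μ ν]
  simp only [Equiv.neg_apply, Pi.neg_apply, neg_mul_neg, neg_neg]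

/-- [folklore] The same in `B12Beta.secondMoment` currency. -/
theorem secondMoment_TOfLeg_eq_of_block (hA : Spr A) (hAcov : ∀ t : Site 4, shiftK (-((n : ℤ) • t)) A = A)
    (hS : ∀ κ' u, BiLoc (S κ' u) u u Cs δ) (hW : ∀ κ' u l' u', BiLoc (Wf κ' u l' u') u u' C2 δ) (hδ : 0 < δ)
    (hScov : ∀ (κ' : Fin 4) (u t : Site 4), S κ' (u + (n : ℤ) • t) = shiftK (-((n : ℤ) • t)) (S κ' u))
    (hWcov : ∀ (κ' : Fin 4) (u : Site 4) (l' : Fin 4) (u' t : Site 4),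
      Wf κ' (u + (n : ℤ) • t) l' (u' + (n : ℤ) • t) = shiftK (-((n : ℤ) • t)) (Wf κ' u l' u'))
    (hWsymm : ∀ (κ' : Fin 4) (u : Site 4) (l' : Fin 4) (u' : Site 4), Wf κ' u l' u' = Wf l' u' κ' u)
    (hrow : ∀ (κ' l' : Fin 4) (b : Site 4), HasSum (fineHessA A S Wf κ' l' b) 0)
    (hT1 : ∀ (κ' l' μ' : Fin 4), ∑ r : Fin 4 → Fin n, ∑' t, (t μ' : ℝ) * baseKer (fineHessA A S Wf κ' l') (resSite r) t = 0)
    (κ lam μ ν : Fin 4) :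
    ∑' z : Site 4, TOfLeg n A S (tableRedF n Wf) μ ν z * (z κ : ℝ) * (z lam : ℝ)
      = ((n : ℝ) ^ 8)⁻¹ * avgM2 n (fineHessA A S Wf μ ν) κ lam := by
  have hn' : (n : ℝ) ^ 8 ≠ 0 := pow_ne_zero 8 (by exact_mod_cast NeZero.ne n)
  have h := bondSecondMoment_TOfLeg_eq_avgM2_of_block n A hA hAcov hS hW hδ hScov hWcov hWsymm hrow hT1 κ lam μ ν
  have e : (fun z : Site 4 => ((z κ * z lam : ℤ) : ℝ) * ((n : ℝ) ^ 8 * TOfLeg n A S (tableRedF n Wf) μ ν z))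
      = fun z => (n : ℝ) ^ 8 * (TOfLeg n A S (tableRedF n Wf) μ ν z * (z κ : ℝ) * (z lam : ℝ)) := by
    funext z
    push_cast
    ring
  rw [e, tsum_mul_left] at h
  rw [← h, ← mul_assoc, inv_mul_cancel₀ hn', one_mul]

/-- [folklore] **BLOCK-COVARIANT DATA, PARITY BY INVERSION**: the first-moment input discharged by an affine inversion covariance of
`fineHessA A S Wf` (`MomentTransferParity.sum_firstMoment_baseKer_eq_zero_of_inversion`). -/
theorem bondSecondMoment_TOfLeg_eq_avgM2_of_inversion_of_block (hA : Spr A) (hAcov : ∀ t : Site 4, shiftK (-((n : ℤ) • t)) A = A)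
    (hS : ∀ κ' u, BiLoc (S κ' u) u u Cs δ) (hW : ∀ κ' u l' u', BiLoc (Wf κ' u l' u') u u' C2 δ) (hδ : 0 < δ)
    (hScov : ∀ (κ' : Fin 4) (u t : Site 4), S κ' (u + (n : ℤ) • t) = shiftK (-((n : ℤ) • t)) (S κ' u))
    (hWcov : ∀ (κ' : Fin 4) (u : Site 4) (l' : Fin 4) (u' t : Site 4),
      Wf κ' (u + (n : ℤ) • t) l' (u' + (n : ℤ) • t) = shiftK (-((n : ℤ) • t)) (Wf κ' u l' u'))
    (hWsymm : ∀ (κ' : Fin 4) (u : Site 4) (l' : Fin 4) (u' : Site 4), Wf κ' u l' u' = Wf l' u' κ' u)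
    (hrow : ∀ (κ' l' : Fin 4) (b : Site 4), HasSum (fineHessA A S Wf κ' l' b) 0)
    {a₁ a₂ : Fin 4 → Site 4}
    (hinv : ∀ (κ' l' : Fin 4) (s s' : Site 4), fineHessA A S Wf κ' l' (a₁ κ' - s) (a₂ l' - s') = fineHessA A S Wf κ' l' s s')
    (κ lam μ ν : Fin 4) :
    ∑' z : Site 4, ((z κ * z lam : ℤ) : ℝ) * ((n : ℝ) ^ 8 * TOfLeg n A S (tableRedF n Wf) μ ν z)
      = avgM2 n (fineHessA A S Wf μ ν) κ lam := by
  have hN : 0 < n := Nat.pos_of_ne_zero (NeZero.ne n)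
  have hcol : ∀ (κ' l' : Fin 4) (b : Site 4), HasSum (baseKer (fineHessA A S Wf κ' l') b) 0 := fun κ' l' b =>
    ((Equiv.hasSum_iff (Equiv.addLeft b)).mpr
      ((hrow l' κ' b).congr_fun fun s => fineHessA_transpose A hA hS hδ hWsymm κ' l' s b)).congr_fun (fun _ => rfl)
  have hT1 : ∀ (κ' l' μ' : Fin 4), ∑ r : Fin 4 → Fin n, ∑' t, (t μ' : ℝ) * baseKer (fineHessA A S Wf κ' l') (resSite r) t = 0 :=
    fun κ' l' μ' => sum_firstMoment_baseKer_eq_zero_of_inversion hN (isBlockPeriodic_fineHessA_of_block n A hAcov hScov hWcov κ' l')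
      (hinv κ' l') (absMoment₂_periodicMajorant (absMoment₂_baseKer_fineHessA A hA hS hW hδ κ' l'))
      (abs_baseKer_le_periodicMajorant hN (isBlockPeriodic_fineHessA_of_block n A hAcov hScov hWcov κ' l')) (hcol κ' l') μ'
  exact bondSecondMoment_TOfLeg_eq_avgM2_of_block n A hA hAcov hS hW hδ hScov hWcov hWsymm hrow hT1 κ lam μ ν

/-! ## §2 The diagonal extension of a one-bond table -/

section Diag

variable {G : Type*}

/-- [our object] **THE DIAGONAL EXTENSION** of a one-bond table `T κ′ u : MKer 4 G` to the two-bond slot: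
`diagExt T κ′ u λ′ u′ := T κ′ u` if `(κ′, u) = (λ′, u′)`, else `0` (the shape of T6's `Wgh = [same bond]·cW·ghCnt`).  A DEFINITION. -/
def diagExt (T : Fin 4 → Site 4 → MKer 4 G) : Fin 4 → Site 4 → Fin 4 → Site 4 → MKer 4 G :=
  fun κ' u l' u' => if κ' = l' ∧ u = u' then T κ' u else 0

variable (T : Fin 4 → Site 4 → MKer 4 G)

/-- [our object] Unfolding, entrywise. -/
theorem diagExt_apply (κ' : Fin 4) (u : Site 4) (l' : Fin 4) (u' x z : Site 4) (a b : G) :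
    diagExt T κ' u l' u' x z a b = if κ' = l' ∧ u = u' then T κ' u x z a b else 0 := by
  unfold diagExt
  split_ifs <;> rfl

/-- [our object] On the diagonal. -/
theorem diagExt_self (κ' : Fin 4) (u : Site 4) : diagExt T κ' u κ' u = T κ' u := by
  simp [diagExt]

/-- [folklore] SYMMETRY of the diagonal extension in its two bonds (no hypothesis). -/
theorem diagExt_symm (κ' : Fin 4) (u : Site 4) (l' : Fin 4) (u' : Site 4) : diagExt T κ' u l' u' = diagExt T l' u' κ' u := by
  unfold diagExt
  by_cases h : κ' = l' ∧ u = u'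
  · obtain ⟨h1, h2⟩ := h
    subst h1; subst h2
    simp
  · have h' : ¬(l' = κ' ∧ u' = u) := fun hh => h ⟨hh.1.symm, hh.2.symm⟩
    rw [if_neg h, if_neg h']

/-- [folklore] BI-LOCALISATION of the diagonal extension at its two bonds from self-localisation of the one-bond table (`0 ≤ C`). -/
theorem biLoc_diagExt {C δ' : ℝ} (hT : ∀ κ' u, BiLoc (T κ' u) u u C δ') (hC : 0 ≤ C) (κ' : Fin 4) (u : Site 4) (l' : Fin 4)
    (u' : Site 4) : BiLoc (diagExt T κ' u l' u') u u' C δ' := by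
  intro x z a b
  rw [diagExt_apply]
  split_ifs with h
  · obtain ⟨-, h2⟩ := h
    subst h2
    exact hT κ' u x z a b
  · rw [abs_zero]; positivity

/-- [folklore] Translation covariance of the diagonal extension from that of the table (any family of translations; stated for the
vectors `v` the hypothesis provides). -/
theorem diagExt_translate {ι : Type*} (τ : ι → Site 4) (hT : ∀ (κ' : Fin 4) (u : Site 4) (i : ι), T κ' (u + τ i) = shiftK (-(τ i)) (T κ' u))
    (κ' : Fin 4) (u : Site 4) (l' : Fin 4) (u' : Site 4) (i : ι) :
    diagExt T κ' (u + τ i) l' (u' + τ i) = shiftK (-(τ i)) (diagExt T κ' u l' u') := by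
  unfold diagExt
  by_cases h : κ' = l' ∧ u = u'
  · have h' : κ' = l' ∧ u + τ i = u' + τ i := ⟨h.1, by rw [h.2]⟩
    rw [if_pos h, if_pos h', hT]
  · have h' : ¬(κ' = l' ∧ u + τ i = u' + τ i) := fun hh => h ⟨hh.1, add_right_cancel hh.2⟩
    rw [if_neg h, if_neg h']
    funext x z a b
    rfl

/-- [folklore] **THE INNER SUPERPOSITION COLLAPSES** on a diagonal extension (no summability needed — one nonzero term):
`wsum w (diagExt T κ′ u λ′) x z a b = [κ′ = λ′] · w u · T κ′ u x z a b`. -/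
theorem wsum_diagExt_apply (w : Site 4 → ℝ) (κ' : Fin 4) (u : Site 4) (l' : Fin 4) (x z : Site 4) (a b : G) :
    wsum w (diagExt T κ' u l') x z a b = if κ' = l' then w u * T κ' u x z a b else 0 := by
  show ∑' u', w u' * diagExt T κ' u l' u' x z a b = _
  simp only [diagExt_apply]
  by_cases h : κ' = l'
  · rw [if_pos h, tsum_eq_single u]
    · simp [h]
    · intro u' hu'
      rw [if_neg (fun hh => hu' hh.2.symm), mul_zero]
  · simp [h]

/-- [folklore] **THE TYPER'S DRESSED TABLE OF A DIAGONAL EXTENSION IS THE COLLAPSED SINGLE SUPERPOSITION** (the body of leaf-04's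
`GhostKernel.tableRedDiag`), with NO hypothesis:
`tableRedF n (diagExt T) μ y ν y′ x z a b = Σ_{κ′} Σ′_u wH κ′ μ (u − n•y) · wH κ′ ν (u − n•y′) · T κ′ u x z a b`. -/
theorem tableRedF_diagExt_apply (μ : Fin 4) (y : Site 4) (ν : Fin 4) (y' x z : Site 4) (a b : G) :
    tableRedF n (diagExt T) μ y ν y' x z a b = ∑ κ' : Fin 4,
      wsum (fun u => wH (N := n) (d := 3) κ' μ (u - (n : ℤ) • y) * wH (N := n) (d := 3) κ' ν (u - (n : ℤ) • y')) (T κ') x z a b := by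
  rw [tableRedF_apply]
  refine Finset.sum_congr rfl fun κ' _ => ?_
  have inner : ∀ l' : Fin 4, wsum (fun u => wH (N := n) (d := 3) κ' μ (u - (n : ℤ) • y))
      (fun u => wsum (fun u' => wH (N := n) (d := 3) l' ν (u' - (n : ℤ) • y')) (diagExt T κ' u l')) x z a b
      = if κ' = l' then wsum (fun u => wH (N := n) (d := 3) κ' μ (u - (n : ℤ) • y) * wH (N := n) (d := 3) κ' ν (u - (n : ℤ) • y'))
          (T κ') x z a b else 0 := by
    intro l'
    show ∑' u, wH (N := n) (d := 3) κ' μ (u - (n : ℤ) • y)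
        * wsum (fun u' => wH (N := n) (d := 3) l' ν (u' - (n : ℤ) • y')) (diagExt T κ' u l') x z a b = _
    simp only [wsum_diagExt_apply]
    by_cases h : κ' = l'
    · subst h
      simp only [if_true]
      show _ = ∑' u, _
      exact tsum_congr fun u => by ring
    · simp [h]
  simp only [inner, Finset.sum_ite_eq, Finset.mem_univ, if_true]

end Diag

end Summit.QuantumFields.BalabanUV.Beta.D1BFx.ReducedKernelSandwichBlock

end
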